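import Literature.Probability.RandomPlanarGeometry.USTPeanoPrimalGraph
import HarnessLib

/-!
# Peano paths and spanning trees containing `α` are equinumerous ([LSW04] §4.1)

G. F. Lawler, O. Schramm, W. Werner, Ann. Probab. **32** (2004), §4.1, p. 972: "`T ↦ γ(T)` is a
bijection between the set of spanning trees of `H` containing `α` and the set of oriented paths
in `G⃗ ∩ D̄` from `a` to `b` containing `V_P`."  For good peeling data `S`
(`USTPeanoPeeling.lean`) and its primal graph `H` with root set `α` (`USTPeanoPrimalGraph.lean`)
we prove that the rooted spanning forests of `(H, α)` — the spanning trees of `H` containing `α`,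
oriented towards `α` — are as many as the Peano paths:
`Good.card_forest_eq_card_isPath`.  Both sides satisfy the same recursion under peeling off the
first vertex ([LSW04] Lemma 4.1): the paths by `PeelData.card_isPath_eq` (`USTPeanoMarkov.lean`),
the forests by deletion–contraction of the edge `f₁ = [α_a, farP a]`
(`RootedSpanningForestsSplit.lean`) — a forest uses `f₁` (as the parent edge of `farP a`) iff
the corresponding path starts with the dual step — with the case analysis:

* `Good.forestUsesEquiv` (dual step available, `farP a ∉ α`): forests using `f₁` ≃ forests of
  `S.peelE` (root set `α ∪ {farP a}`);
* `Good.forestAvoidsEquiv` (primal step available, prepend case): forests avoiding `f₁` ≃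
  forests of `S.peelP` (the edge `f₁` disappears: its other witness `coSrc a` is now blocked);
* `Good.forestEquivPeelEOfEq` (dual step along the dangling first edge of `α`), and
  `Good.forestEquivPeelP` (dual step unavailable): all forests ≃ forests of the peeled data;
* `Good.parent_farP_eq` — **the parity lemma on the tree side**: if the dual step is available
  with `farP a ∉ α` but the primal step is not (`farD a` deep inside `β`), EVERY forest uses
  `f₁`: otherwise the branch from `farP a` to `α`, continued along `α` back to `α_a` and closed
  by `f₁`, is a closed primal walk crossed exactly once (in `(f₁, f₂)`) by the closed dual walk
  `β_a, …, farD a, β_a` — against `crossings_mod_two`.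
-/

namespace Literature.Probability.RandomPlanarGeometry

namespace USTPeano

open Literature.Probability.LatticeModels

/-! ### List lemmas -/

/-- Consecutive pairs of the reverse are reversed consecutive pairs. [folklore] -/
theorem mem_zip_tail_reverse {x y : ℤ × ℤ} :
    ∀ {l : List (ℤ × ℤ)}, (x, y) ∈ l.reverse.zip l.reverse.tail ↔ (y, x) ∈ l.zip l.tail
  | [] => by simp
  | u :: t => by
    by_cases ht : t = []
    · subst ht; simp
    · have htr : t.reverse ≠ [] := by simpa using ht
      rw [List.reverse_cons, zip_tail_append_singleton _ htr, List.mem_append, List.mem_singleton,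
        mem_zip_tail_reverse, mem_zip_cons_iff u t ht, List.getLast_reverse]
      simp only [Prod.mk.injEq]
      constructor
      · rintro (h | ⟨rfl, rfl⟩)
        · exact Or.inr h
        · exact Or.inl ⟨rfl, rfl⟩
      · rintro (⟨rfl, rfl⟩ | h)
        · exact Or.inr ⟨rfl, rfl⟩
        · exact Or.inl h

/-- Consecutive pairs of a concatenation. [folklore] -/
theorem mem_zip_tail_append {X : Type*} {e : X × X} :
    ∀ {l₁ l₂ : List X}, e ∈ (l₁ ++ l₂).zip (l₁ ++ l₂).tail →
      e ∈ l₁.zip l₁.tail ∨ (∃ h₁ : l₁ ≠ [], ∃ h₂ : l₂ ≠ [], e = (l₁.getLast h₁, l₂.head h₂)) ∨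
        e ∈ l₂.zip l₂.tail
  | [], l₂, h => Or.inr (Or.inr h)
  | [u], l₂, h => by
    cases l₂ with
    | nil => simp at h
    | cons v t =>
      rw [List.singleton_append, show (u :: v :: t).zip (u :: v :: t).tail =
        (u, v) :: (v :: t).zip (v :: t).tail from rfl, List.mem_cons] at h
      rcases h with rfl | h
      · exact Or.inr (Or.inl ⟨List.cons_ne_nil _ _, List.cons_ne_nil _ _, rfl⟩)
      · exact Or.inr (Or.inr h)
  | u :: v :: t, l₂, h => by
    rw [List.cons_append, List.cons_append, show (u :: (v :: (t ++ l₂))).zip (u :: (v :: (t ++ l₂))).tail =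
      (u, v) :: (v :: (t ++ l₂)).zip (v :: (t ++ l₂)).tail from rfl, List.mem_cons, ← List.cons_append] at h
    rcases h with rfl | h
    · left
      exact List.mem_cons_self
    · rcases mem_zip_tail_append h with h | ⟨h₁, h₂, rfl⟩ | h
      · left
        exact List.mem_cons_of_mem _ h
      · right; left
        refine ⟨List.cons_ne_nil _ _, h₂, ?_⟩
        rw [List.getLast_cons h₁]
      · exact Or.inr (Or.inr h)

/-- An element of the tail has a predecessor. [folklore] -/
theorem exists_mem_zip_tail_of_mem_tail {X : Type*} {y : X} :
    ∀ {l : List X}, y ∈ l.tail → ∃ x, (x, y) ∈ l.zip l.tail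
  | [], h => by simp at h
  | [u], h => by simp at h
  | u :: v :: t, h => by
    rw [List.tail_cons, List.mem_cons] at h
    rcases h with rfl | h
    · exact ⟨u, List.mem_cons_self⟩
    · obtain ⟨x, hx⟩ := exists_mem_zip_tail_of_mem_tail (l := v :: t) h
      exact ⟨x, List.mem_cons_of_mem _ hx⟩

namespace PeelData

variable {S : PeelData} {P₀ : Finset (ℤ × ℤ)}

/-! ### The two endpoints of `f₁` as vertices -/

/-- `a` is a Peano vertex of `D̄`. [folklore] -/
theorem a_mem_pts (S : PeelData) : S.a ∈ S.pts := by simp [pts]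

/-- `α_a` lies in the ambient set. [folklore] -/
theorem primalNbr_a_mem_amb (S : PeelData) : primalNbr S.a ∈ S.amb :=
  S.mem_amb.2 (Or.inr (Or.inl ⟨S.a, S.a_mem_pts, rfl⟩))

/-- `farP a` lies in the ambient set. [folklore] -/
theorem farP_a_mem_amb (S : PeelData) : farP S.a ∈ S.amb :=
  S.mem_amb.2 (Or.inr (Or.inr ⟨S.a, S.a_mem_pts, rfl⟩))

/-- The vertex `α_a` of `↥P₀`. [folklore] -/
def U₀ (S : PeelData) (hP : S.amb ⊆ P₀) : ↥P₀ := ⟨primalNbr S.a, hP S.primalNbr_a_mem_amb⟩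

/-- The vertex `farP a` of `↥P₀`. [folklore] -/
def W₀ (S : PeelData) (hP : S.amb ⊆ P₀) : ↥P₀ := ⟨farP S.a, hP S.farP_a_mem_amb⟩

/-- `α_a` is a root. [folklore] -/
theorem Good.U₀_mem_roots (h : S.Good) (hP : S.amb ⊆ P₀) : S.U₀ hP ∈ S.roots P₀ :=
  (S.mem_roots).2 (Or.inl h.primalNbr_a_mem)

/-- `farP a ≠ α_a` as vertices. [folklore] -/
theorem W₀_ne_U₀ (hP : S.amb ⊆ P₀) : S.W₀ hP ≠ S.U₀ hP := fun h ↦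
  farP_ne_primalNbr S.a (congrArg Subtype.val h)

/-- In the case `farP a ∉ α` of an available dual step, `farP a` is not a root. [folklore] -/
theorem Good.W₀_not_mem_roots (h : S.Good) (hP : S.amb ⊆ P₀) (h2 : s(dualNbr S.a, farD S.a) ∉ edgeSet S.β)
    (hn : farP S.a ∉ S.α) : S.W₀ hP ∉ S.roots P₀ := by
  rw [mem_roots, not_or, not_not]
  exact ⟨hn, h.farP_mem_vH (Or.inl rfl) (by rwa [blocked_stepD_iff])⟩

/-- `f₁` is an edge of `H` when the dual step at `a` is unblocked. [folklore] -/
theorem adj_W₀_U₀ (hP : S.amb ⊆ P₀) (h2 : s(dualNbr S.a, farD S.a) ∉ edgeSet S.β) :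
    (S.primalGraph P₀).Adj (S.W₀ hP) (S.U₀ hP) := by
  rw [primalGraph_adj]
  refine ⟨W₀_ne_U₀ hP, ?_⟩
  show S.EdgeWit s(farP S.a, primalNbr S.a)
  rw [Sym2.eq_swap]
  exact (edgeWit_f₁_iff).2 h2

/-- The unordered pair `{farP a, α_a}` of vertices projects to `f₁`. [folklore] -/
theorem sym2_eq_W₀_U₀_iff (hP : S.amb ⊆ P₀) {u v : ↥P₀} :
    s(u, v) = s(S.W₀ hP, S.U₀ hP) ↔ s(u.1, v.1) = s(primalNbr S.a, farP S.a) := by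
  rw [Sym2.eq_iff, Sym2.eq_iff, Subtype.ext_iff, Subtype.ext_iff, Subtype.ext_iff, Subtype.ext_iff]
  show (u.1 = farP S.a ∧ v.1 = primalNbr S.a ∨ u.1 = primalNbr S.a ∧ v.1 = farP S.a) ↔ _
  tauto

/-! ### The forests after peeling: the four identifications -/

/-- **Case A** (`f₂` free, `farP a ∉ α`): the forests in which `α_a` is the parent of
`farP a` ("using `f₁`") are the forests of the peeled data `S.peelE`, whose root set is
`α ∪ {farP a}` and whose edges from non-roots are the same. [cite: LawlerSchrammWerner2004, Lemma 4.1] -/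
noncomputable def Good.forestUsesEquiv (h : S.Good) (hP : S.amb ⊆ P₀) (hE : S.CanE)
    (hb : stepD S.a ≠ S.b) (hn : farP S.a ∉ S.α) :
    {F : Forest (S.primalGraph P₀) (S.roots P₀) // F.parent (S.W₀ hP) = S.U₀ hP} ≃
      Forest (S.peelE.primalGraph P₀) (S.peelE.roots P₀) :=
  have hroots : insert (S.W₀ hP) (S.roots P₀) = S.peelE.roots P₀ := by
    ext u
    rw [Finset.mem_insert, h.mem_roots_peelE_of_notMem hE hb hn]
    refine or_congr ⟨fun e ↦ congrArg Subtype.val e, fun e ↦ Subtype.ext e⟩ Iff.rfl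
  have hagree : ∀ ⦃u v : ↥P₀⦄, u ∉ S.peelE.roots P₀ →
      ((S.primalGraph P₀).Adj u v ↔ (S.peelE.primalGraph P₀).Adj u v) := by
    intro u v hu
    rw [h.mem_roots_peelE_of_notMem hE hb hn, not_or, mem_roots, not_or] at hu
    have hu₁ : u.1 ≠ farP S.a := hu.1
    have hu₂ : u.1 ≠ primalNbr S.a := fun e ↦ hu.2.1 (e ▸ h.primalNbr_a_mem)
    rw [primalGraph_adj, primalGraph_adj, h.edgeWit_peelE_iff hE hb]
    refine and_congr Iff.rfl ⟨?_, ?_⟩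
    · rintro ⟨p, hp, hub, he⟩
      rcases hp with rfl | hp
      · exfalso
        rcases Sym2.eq_iff.1 he with ⟨h1, -⟩ | ⟨h1, -⟩
        · exact hu₂ h1
        · exact hu₁ h1
      · exact ⟨p, hp, hub, he⟩
    · rintro ⟨p, hp, hub, he⟩
      exact ⟨p, Or.inr hp, hub, he⟩
  (Forest.parentEqEquiv (h.W₀_not_mem_roots hP hE.1 hn) (h.U₀_mem_roots hP) (adj_W₀_U₀ hP hE.1)).trans
    ((Forest.castRoots hroots).trans (Forest.adjEquiv hagree))

/-- The forests in which `α_a` is not the parent of `farP a` are the forests of `H` with `f₁`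
deleted. [folklore] -/
def Good.forestAvoidsEquivDelete (h : S.Good) (hP : S.amb ⊆ P₀) :
    {F : Forest (S.primalGraph P₀) (S.roots P₀) // F.parent (S.W₀ hP) ≠ S.U₀ hP} ≃
      Forest ((S.primalGraph P₀).deleteEdges {s(S.W₀ hP, S.U₀ hP)}) (S.roots P₀) :=
  Forest.parentNeEquiv (h.U₀_mem_roots hP) (W₀_ne_U₀ hP)

/-- **Primal step available**: the forests of `H` with `f₁` deleted are the forests of the
peeled data `S.peelP` (same roots; its edges are the old ones witnessed from `V ∖ {coSrc a}`,
i.e. all but `f₁`). [cite: LawlerSchrammWerner2004, Lemma 4.1] -/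
noncomputable def Good.forestDeleteEquivPeelP (h : S.Good) (hP : S.amb ⊆ P₀) (hE : S.swap.CanE)
    (hb : stepD S.swap.a ≠ S.swap.b) :
    Forest ((S.primalGraph P₀).deleteEdges {s(S.W₀ hP, S.U₀ hP)}) (S.roots P₀) ≃
      Forest (S.peelP.primalGraph P₀) (S.peelP.roots P₀) :=
  have hagree : ∀ ⦃u v : ↥P₀⦄, u ∉ S.roots P₀ →
      (((S.primalGraph P₀).deleteEdges {s(S.W₀ hP, S.U₀ hP)}).Adj u v ↔
        (S.peelP.primalGraph P₀).Adj u v) := by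
    intro u v _
    rw [SimpleGraph.deleteEdges_adj, primalGraph_adj, primalGraph_adj, Set.mem_singleton_iff,
      sym2_eq_W₀_U₀_iff, and_assoc, h.edgeWit_and_ne_f₁_iff, h.edgeWit_peelP_iff hE hb]
  (Forest.adjEquiv hagree).trans (Forest.castRoots (h.roots_peelP hE hb P₀).symm)

/-- **Case B** (dual step along the dangling first edge `[α_a, farP a]` of `α`): all forests are
forests of the peeled data (same roots; `α_a` becomes an isolated padding vertex).
[cite: LawlerSchrammWerner2004, Lemma 4.1] -/
noncomputable def Good.forestEquivPeelEOfEq (h : S.Good) (hE : S.CanE) (hb : stepD S.a ≠ S.b)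
    {t : List (ℤ × ℤ)} (ht : S.α = primalNbr S.a :: farP S.a :: t) :
    Forest (S.primalGraph P₀) (S.roots P₀) ≃ Forest (S.peelE.primalGraph P₀) (S.peelE.roots P₀) :=
  have hagree : ∀ ⦃u v : ↥P₀⦄, u ∉ S.roots P₀ →
      ((S.primalGraph P₀).Adj u v ↔ (S.peelE.primalGraph P₀).Adj u v) := by
    intro u v hu
    rw [not_mem_roots] at hu
    have hu₁ : u.1 ≠ farP S.a := fun e ↦ hu.1 (by rw [e, ht]; simp)
    have hu₂ : u.1 ≠ primalNbr S.a := fun e ↦ hu.1 (e ▸ h.primalNbr_a_mem)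
    rw [primalGraph_adj, primalGraph_adj, h.edgeWit_peelE_iff hE hb]
    refine and_congr Iff.rfl ⟨?_, ?_⟩
    · rintro ⟨p, hp, hub, he⟩
      rcases hp with rfl | hp
      · exfalso
        rcases Sym2.eq_iff.1 he with ⟨h1, -⟩ | ⟨h1, -⟩
        · exact hu₂ h1
        · exact hu₁ h1
      · exact ⟨p, hp, hub, he⟩
    · rintro ⟨p, hp, hub, he⟩
      exact ⟨p, Or.inr hp, hub, he⟩
  (Forest.adjEquiv hagree).trans (Forest.castRoots (h.roots_peelE_of_eq hE hb ht P₀).symm)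

/-- **Dual step unavailable, or `farP a` on `α`**: all forests are forests of `S.peelP`
(from a non-root, the lost witnesses `a`, `coSrc a` of `f₁` are irrelevant: either `f₁` joins
two vertices of `α`, or the dual steps of `a` and `coSrc a` are blocked by `f₂ ∈ β`).
[cite: LawlerSchrammWerner2004, Lemma 4.1] -/
noncomputable def Good.forestEquivPeelP (h : S.Good) (hE : S.swap.CanE) (hb : stepD S.swap.a ≠ S.swap.b)
    (hC : farP S.a ∈ S.α ∨ s(dualNbr S.a, farD S.a) ∈ edgeSet S.β) :
    Forest (S.primalGraph P₀) (S.roots P₀) ≃ Forest (S.peelP.primalGraph P₀) (S.peelP.roots P₀) :=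
  have hagree : ∀ ⦃u v : ↥P₀⦄, u ∉ S.roots P₀ →
      ((S.primalGraph P₀).Adj u v ↔ (S.peelP.primalGraph P₀).Adj u v) := by
    intro u v hu
    rw [not_mem_roots] at hu
    rw [primalGraph_adj, primalGraph_adj, h.edgeWit_peelP_iff hE hb]
    refine and_congr Iff.rfl ⟨?_, ?_⟩
    · rintro ⟨p, hp, hub, he⟩
      -- the witnesses `a` and `coSrc a` (of `f₁`) cannot occur
      have hpa : p ≠ S.a := by
        rintro rfl
        rcases hC with hC | hC
        · rcases Sym2.eq_iff.1 he with ⟨h1, -⟩ | ⟨h1, -⟩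
          · exact hu.1 (h1 ▸ h.primalNbr_a_mem)
          · exact hu.1 (h1 ▸ hC)
        · exact hub (by rwa [blocked_stepD_iff])
      have hpV : p ∈ S.V := hp.resolve_left hpa
      have hpc : p ≠ coSrc S.a := by
        rintro rfl
        rcases hC with hC | hC
        · rw [primalNbr_coSrc, farP_coSrc] at he
          rcases Sym2.eq_iff.1 he with ⟨h1, -⟩ | ⟨h1, -⟩
          · exact hu.1 (h1 ▸ hC)
          · exact hu.1 (h1 ▸ h.primalNbr_a_mem)
        · apply hub
          rw [blocked_stepD_iff, dualNbr_coSrc, farD_coSrc, Sym2.eq_swap]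
          exact hC
      exact ⟨p, hpV, hpc, hub, he⟩
    · rintro ⟨p, hp, -, hub, he⟩
      exact ⟨p, Or.inr hp, hub, he⟩
  (Forest.adjEquiv hagree).trans (Forest.castRoots (h.roots_peelP hE hb P₀).symm)


end PeelData

/-- Consecutive pairs of a mapped list. [folklore] -/
theorem mem_zip_tail_map {X Y : Type*} {f : X → Y} :
    ∀ {l : List X} {e : Y × Y}, e ∈ (l.map f).zip (l.map f).tail →
      ∃ e' ∈ l.zip l.tail, (f e'.1, f e'.2) = e
  | [], e, h => by simp at h
  | [x], e, h => by simp at h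
  | x :: y :: t, e, h => by
    rw [List.map_cons, List.map_cons, show (f x :: f y :: t.map f).zip (f x :: f y :: t.map f).tail =
      (f x, f y) :: (f y :: t.map f).zip (f y :: t.map f).tail from rfl, List.mem_cons,
      ← List.map_cons] at h
    rcases h with rfl | h
    · exact ⟨(x, y), List.mem_cons_self, rfl⟩
    · obtain ⟨e', he', rfl⟩ := mem_zip_tail_map h
      exact ⟨e', List.mem_cons_of_mem _ he', rfl⟩

/-- Consecutive pairs are mapped to consecutive pairs. [folklore] -/
theorem mem_zip_tail_map_of_mem {X Y : Type*} {f : X → Y} :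
    ∀ {l : List X} {e : X × X}, e ∈ l.zip l.tail → (f e.1, f e.2) ∈ (l.map f).zip (l.map f).tail
  | [], e, h => by simp at h
  | [x], e, h => by simp at h
  | x :: y :: t, e, h => by
    rw [show (x :: y :: t).zip (x :: y :: t).tail = (x, y) :: (y :: t).zip (y :: t).tail from rfl,
      List.mem_cons] at h
    rw [List.map_cons, List.map_cons, show (f x :: f y :: t.map f).zip (f x :: f y :: t.map f).tail =
      (f x, f y) :: (f y :: t.map f).zip (f y :: t.map f).tail from rfl, List.mem_cons, ← List.map_cons]
    rcases h with rfl | h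
    · exact Or.inl rfl
    · exact Or.inr (mem_zip_tail_map_of_mem h)

namespace PeelData

variable {S : PeelData} {P₀ : Finset (ℤ × ℤ)}

/-! ### The parity lemma on the tree side -/

/-- **If the dual step is available with `farP a ∉ α` while `farD a` lies on `β` without `f₂`
being a wall, every forest uses `f₁`**: `α_a` is the parent of `farP a`.  Otherwise the branch
from `farP a` reaches `α` at some `r`; following `α` back from `r` to `α_a` and closing with
`f₁` gives a closed primal walk; the dual walk `β_a, …, farD a` closed by `f₂` crosses it exactly
once: branch edges are alongside available dual steps, so cross no wall and not `f₂` (that would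
make the edge `f₁`, used only as the first edge — excluded); `α`-edges cross no `β`-edge and not
`f₂` (`f₁ ∉ α`); and `f₁` crosses `f₂` only.  The parity lemma `crossings_mod_two` forbids this.
[cite: LawlerSchrammWerner2004, Lemma 4.1] -/
theorem Good.parent_W₀_eq (h : S.Good) (hP : S.amb ⊆ P₀) (h2 : s(dualNbr S.a, farD S.a) ∉ edgeSet S.β)
    (hn : farP S.a ∉ S.α) (hfar : farD S.a ∈ S.β) (F : Forest (S.primalGraph P₀) (S.roots P₀)) :
    F.parent (S.W₀ hP) = S.U₀ hP := by
  by_contra hne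
  have hW₀R : S.W₀ hP ∉ S.roots P₀ := h.W₀_not_mem_roots hP h2 hn
  have h1 : s(primalNbr S.a, farP S.a) ∉ edgeSet S.α := fun hm ↦ hn (mem_of_mem_edgeSet hm).2
  -- the branch from `farP a` and its projection to `ℤ²`
  set brW := F.br (S.W₀ hP) with hbrW
  have hst : IsStoppedAt (↑(S.roots P₀) : Set ↥P₀) (S.W₀ hP :: brW) := F.isStoppedAt_br hW₀R
  have hch : List.IsChain (S.primalGraph P₀).Adj (S.W₀ hP :: brW) := F.isChain_br hW₀R
  have hnd : (S.W₀ hP :: brW).Nodup := F.nodup_br hW₀R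
  have hparch := F.isChain_parent_br (S.W₀ hP)
  have hbrWne : brW ≠ [] := by
    intro e
    have := hst.getLast_mem
    simp only [e, List.getLast_singleton, Finset.mem_coe] at this
    exact hW₀R this
  have hheadW : brW.head hbrWne = F.parent (S.W₀ hP) := by
    have := (List.isChain_cons.1 hparch).1 (brW.head hbrWne) (List.head?_eq_some_head hbrWne)
    exact this.symm
  set br := (S.W₀ hP :: brW).map Subtype.val with hbr
  have hbrne : br ≠ [] := by simp [hbr]
  have hbrc : br.IsChain LatticeAdj := by
    rw [hbr, List.isChain_map]
    exact hch.imp fun x y hxy ↦ ((S.primalGraph_adj).1 hxy).2.latticeAdj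
  have hbrnd : br.Nodup := by
    rw [hbr]
    exact hnd.map Subtype.val_injective
  have hbrhead : br.head hbrne = farP S.a := by simp [hbr, W₀]
  -- its last vertex `r` is a root entered through an edge, hence on `α`
  set rW := (S.W₀ hP :: brW).getLast (List.cons_ne_nil _ _) with hrW
  have hrR : rW ∈ S.roots P₀ := by simpa using hst.getLast_mem
  have hrα : rW.1 ∈ S.α := by
    have hrtail : rW ∈ (S.W₀ hP :: brW).tail := by
      rw [List.tail_cons, hrW, List.getLast_cons hbrWne]
      exact List.getLast_mem _
    obtain ⟨x, hx⟩ := exists_mem_zip_tail_of_mem_tail hrtail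
    exact h.mem_α_of_adj_of_mem_roots (forall_zip_tail_of_isChain hch _ hx) hrR
  have hbrlast : br.getLast hbrne = rW.1 := by
    simp only [hbr, hrW, List.getLast_map]
  -- the first edge of the branch is `(farP a, parent (farP a))`
  have hfirst : (farP S.a, (F.parent (S.W₀ hP)).1) ∈ br.zip br.tail := by
    rw [hbr, List.map_cons]
    refine (mem_zip_cons_iff _ _ (by simpa using hbrWne) _).2 (Or.inl ?_)
    simp only [W₀, List.head_map, hheadW]
  -- the prefix of `α` up to `r`, reversed
  obtain ⟨α₁, α₂, hα⟩ := List.append_of_mem hrα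
  have hαP : S.α = (α₁ ++ [rW.1]) ++ α₂ := by rw [hα, List.append_assoc, List.singleton_append]
  have hPc : (rW.1 :: α₁.reverse).IsChain LatticeAdj := by
    have hc : (α₁ ++ [rW.1]).IsChain LatticeAdj := (hαP ▸ h.chainα).left_of_append
    have := List.isChain_reverse.2 (hc.imp fun x y (hxy : LatticeAdj x y) ↦ hxy.symm)
    simpa using this
  -- the primal walk `L = branch ++ (α back to α_a)` and the closed walk `A = L ++ [farP a]`
  set L := br ++ α₁.reverse with hL
  have hLne : L ≠ [] := by simp [hL, hbrne]
  have hLc : L.IsChain LatticeAdj := by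
    refine List.IsChain.append hbrc (List.isChain_cons.1 hPc).2 ?_
    intro x hx y hy
    rw [List.getLast?_eq_getLast_of_ne_nil hbrne, Option.mem_def, Option.some.injEq] at hx
    subst hx
    rw [hbrlast]
    exact (List.isChain_cons.1 hPc).1 y hy
  have hLhead : L.head hLne = farP S.a := by
    simp only [hL, List.head_append_left hbrne, hbrhead]
  have hLlast : L.getLast hLne = primalNbr S.a := by
    by_cases hα₁ : α₁ = []
    · have hr : rW.1 = primalNbr S.a := by
        rw [← h.headα]
        simp only [hα, hα₁, List.nil_append, List.head_cons]
      simp only [hL, hα₁, List.reverse_nil, List.append_nil]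
      rw [hbrlast, hr]
    · have : L.getLast hLne = α₁.reverse.getLast (by simpa using hα₁) := by
        simp only [hL]
        exact List.getLast_append_of_ne_nil _ (by simpa using hα₁)
      rw [this, List.getLast_reverse, ← h.headα]
      simp only [hα]
      exact (List.head_append_left hα₁).symm
  set A := L ++ [farP S.a] with hA
  have hAne : A ≠ [] := by simp [hA]
  have hAc : A.IsChain LatticeAdj := by
    refine List.IsChain.append hLc (List.isChain_singleton _) ?_
    intro x hx y hy
    rw [List.getLast?_eq_getLast_of_ne_nil hLne, Option.mem_def, Option.some.injEq] at hx
    simp only [List.head?_cons, Option.mem_def, Option.some.injEq] at hy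
    subst hx; subst hy
    rw [hLlast]
    exact latticeAdj_primalNbr_farP _
  have hAcl : A.head hAne = A.getLast hAne := by
    simp only [hA, List.getLast_append_singleton]
    rw [List.head_append_left hLne, hLhead]
  -- the dual closed walk `B = (β up to farD a) ++ [β_a]`
  obtain ⟨m₁, m₂, hβ⟩ := List.append_of_mem hfar
  set Q := m₁ ++ [farD S.a] with hQ
  have hβQ : S.β = Q ++ m₂ := by rw [hβ, hQ, List.append_assoc, List.singleton_append]
  have hQne : Q ≠ [] := by simp [hQ]
  have hQlast : Q.getLast hQne = farD S.a := by simp [hQ]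
  have hQhead : Q.head hQne = dualNbr S.a := by
    rw [← h.headβ]
    simp only [hβQ]
    exact (List.head_append_left hQne).symm
  set B := Q ++ [dualNbr S.a] with hB
  have hBne : B ≠ [] := by simp [hB]
  have hBc : B.IsChain LatticeAdj := by
    refine List.IsChain.append (h.chainβ |> fun hc ↦ (hβQ ▸ hc).left_of_append)
      (List.isChain_singleton _) ?_
    intro x hx y hy
    rw [List.getLast?_eq_getLast_of_ne_nil hQne, Option.mem_def, Option.some.injEq] at hx
    simp only [List.head?_cons, Option.mem_def, Option.some.injEq] at hy
    subst hx; subst hy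
    rw [hQlast]
    exact (latticeAdj_dualNbr_farD _).symm
  have hBcl : B.head hBne = B.getLast hBne := by
    simp only [hB, List.getLast_append_singleton]
    rw [List.head_append_left hQne, hQhead]
  have hpar := crossings_mod_two hAne hAc hAcl hBne hBc hBcl
  have hQsub : ∀ f ∈ Q.zip Q.tail, f ∈ S.β.zip S.β.tail := fun f hf ↦
    hβQ ▸ (zip_tail_sublist_append Q m₂).subset hf
  -- classification of the edges of `L`: branch edges (edges of `H`) or `α`-edges
  have hLedges : ∀ e ∈ L.zip L.tail,
      (∃ e' ∈ (S.W₀ hP :: brW).zip (S.W₀ hP :: brW).tail, (e'.1.1, e'.2.1) = e) ∨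
        s(e.1, e.2) ∈ edgeSet S.α := by
    intro e he
    rcases mem_zip_tail_append he with he | ⟨hb₁, hb₂, rfl⟩ | he
    · exact Or.inl (mem_zip_tail_map he)
    · right
      have hα₁ : α₁ ≠ [] := by simpa using hb₂
      dsimp only
      rw [hbrlast, List.head_reverse, Sym2.eq_swap]
      refine mem_edgeSet_iff.2 ⟨(α₁.getLast hα₁, rW.1), ?_, rfl⟩
      rw [hαP]
      refine (zip_tail_sublist_append _ α₂).subset ?_
      rw [zip_tail_append_singleton α₁ hα₁]
      exact List.mem_append_right _ (List.mem_singleton_self _)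
    · right
      rw [mem_zip_tail_reverse] at he
      rw [Sym2.eq_swap]
      refine mem_edgeSet_iff.2 ⟨(e.2, e.1), ?_, rfl⟩
      rw [hα]
      exact (zip_tail_sublist_append α₁ _).subset he
  -- a branch edge is dual to no wall, and is not `f₁`
  have hbranch : ∀ e' ∈ (S.W₀ hP :: brW).zip (S.W₀ hP :: brW).tail,
      (∀ f ∈ Q.zip Q.tail, ¬ IsDualPair e'.1.1 e'.2.1 f.1 f.2) ∧
        ¬ IsDualPair e'.1.1 e'.2.1 (farD S.a) (dualNbr S.a) := by
    intro e' he'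
    have hadj := forall_zip_tail_of_isChain hch _ he'
    obtain ⟨p, -, hub, hpe⟩ := ((S.primalGraph_adj).1 hadj).2
    refine ⟨fun f hf hd ↦ ?_, fun hd ↦ ?_⟩
    · have hd' : IsDualPair (primalNbr p) (farP p) f.1 f.2 := (isDualPair_congr hpe rfl).1 hd
      rw [blocked_stepD_iff] at hub
      exact hub (hd'.eq_of_primal ▸ List.mem_map_of_mem (hQsub f hf))
    · have heq : s(e'.1.1, e'.2.1) = s(primalNbr S.a, farP S.a) := hd.symm_right.eq_of_dual
      rcases Sym2.eq_iff.1 heq with ⟨hx, hy⟩ | ⟨hx, hy⟩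
      · -- `e'.2 = farP a` would be the initial vertex, which is not in the tail
        have : e'.2 = S.W₀ hP := Subtype.ext hy
        exact head_notMem_tail (List.cons_ne_nil _ _) hnd (by simpa [this] using (List.of_mem_zip he').2)
      · -- `e' = (farP a, parent (farP a))`, so the parent is `α_a`
        have he'' : (farP S.a, e'.2.1) ∈ br.zip br.tail := by
          have := mem_zip_tail_map_of_mem (f := Subtype.val) he'
          rw [hx] at this
          exact this
        have hsucc := eq_of_mem_zip_tail_fst hbrnd hfirst he''
        apply hne
        exact Subtype.ext (hsucc.trans hy)
  -- exactly one crossing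
  have hone : crossings A B = 1 := by
    unfold crossings
    rw [hA, hB, zip_tail_append_singleton L hLne, zip_tail_append_singleton Q hQne, hLlast, hQlast]
    simp only [List.map_append, List.map_cons, List.map_nil, List.sum_append, List.sum_cons,
      List.sum_nil, add_zero]
    have hT1 : ((L.zip L.tail).map fun e ↦
        (((Q.zip Q.tail).map fun f ↦ if IsDualPair e.1 e.2 f.1 f.2 then (1 : ℤ) else 0).sum +
          if IsDualPair e.1 e.2 (farD S.a) (dualNbr S.a) then (1 : ℤ) else 0)).sum = 0 := by
      refine sum_map_eq_zero_of_forall _ _ fun e he ↦ ?_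
      rcases hLedges e he with ⟨e', he', rfl⟩ | hes
      · obtain ⟨hq, hc⟩ := hbranch e' he'
        rw [sum_map_eq_zero_of_forall _ _ fun f hf ↦ if_neg (hq f hf), zero_add, if_neg hc]
      · obtain ⟨e', he', hee'⟩ := mem_edgeSet_iff.1 hes
        have hz : ((Q.zip Q.tail).map fun f ↦ if IsDualPair e.1 e.2 f.1 f.2 then (1 : ℤ) else 0).sum =
            0 :=
          sum_map_eq_zero_of_forall _ _ fun f hf ↦ if_neg fun hd ↦
            h.nocross e' he' f (hQsub f hf) ((isDualPair_congr hee' rfl).2 hd)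
        rw [hz, zero_add, if_neg]
        intro hd
        exact h1 (hd.symm_right.eq_of_dual ▸ hes)
    have hT2 : ((Q.zip Q.tail).map fun f ↦
        if IsDualPair (primalNbr S.a) (farP S.a) f.1 f.2 then (1 : ℤ) else 0).sum = 0 :=
      sum_map_eq_zero_of_forall _ _ fun f hf ↦ if_neg
        fun (hd : IsDualPair (primalNbr S.a) (farP S.a) f.1 f.2) ↦
          h2 (hd.eq_of_primal ▸ List.mem_map_of_mem (hQsub f hf))
    rw [hT1, hT2, if_pos (isDualPair_far S.a).symm_right]
    norm_num
  rw [hone] at hpar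
  norm_num at hpar

/-- In that case no forest avoids `f₁`. [folklore] -/
theorem Good.card_forest_avoids_eq_zero (h : S.Good) (hP : S.amb ⊆ P₀)
    (h2 : s(dualNbr S.a, farD S.a) ∉ edgeSet S.β) (hn : farP S.a ∉ S.α) (hfar : farD S.a ∈ S.β) :
    Nat.card {F : Forest (S.primalGraph P₀) (S.roots P₀) // F.parent (S.W₀ hP) ≠ S.U₀ hP} = 0 := by
  rw [Nat.card_eq_zero]
  exact Or.inl ⟨fun F ↦ F.2 (h.parent_W₀_eq hP h2 hn hfar F.1)⟩

/-! ### The base case: no interior vertex -/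

/-- With no interior Peano vertex there is no interior primal vertex. [folklore] -/
theorem inner_eq_empty_of_V_eq_empty (hV : S.V = ∅) : S.inner = ∅ := by
  rw [Finset.eq_empty_iff_forall_notMem]
  intro v hv
  rw [mem_inner_iff] at hv
  have key : ∀ c, primalNbr c = v → c = S.a ∨ c = S.b := fun c hc ↦ by
    have := hv c hc
    rw [mem_pts, hV] at this
    simpa using this
  obtain ⟨m, n⟩ := v
  have h0 := key (2 * m, 2 * n) (primalNbr_ee m n)
  have h1 := key (stepP (2 * m, 2 * n)) (by rw [primalNbr_stepP, primalNbr_ee])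
  have h2 := key (stepP (stepP (2 * m, 2 * n))) (by rw [primalNbr_stepP, primalNbr_stepP, primalNbr_ee])
  have hne := stepP_iter_ne_self (2 * m, 2 * n)
  have hne' := stepP_iter_ne_self (stepP (2 * m, 2 * n))
  rcases h0 with h0 | h0 <;> rcases h1 with h1 | h1 <;> rcases h2 with h2 | h2
  all_goals first
    | exact hne.1 (h1.trans h0.symm)
    | exact hne.2.1 (h2.trans h0.symm)
    | exact hne'.1 (h2.trans h1.symm)

/-- With no interior Peano vertex every vertex is a root. [folklore] -/
theorem mem_roots_of_V_eq_empty (hV : S.V = ∅) {P₀ : Finset (ℤ × ℤ)} (u : ↥P₀) : u ∈ S.roots P₀ := by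
  rw [mem_roots, mem_vH, inner_eq_empty_of_V_eq_empty hV]
  simp only [Finset.notMem_empty, or_false]
  tauto

/-- With no interior Peano vertex every vertex is a root, so there is exactly one forest.
[folklore] -/
theorem card_forest_of_V_eq_empty (hV : S.V = ∅) (P₀ : Finset (ℤ × ℤ)) :
    Nat.card (Forest (S.primalGraph P₀) (S.roots P₀)) = 1 := by
  have hall : ∀ u, u ∈ S.roots P₀ := fun u ↦ mem_roots_of_V_eq_empty hV u
  let F₀ : Forest (S.primalGraph P₀) (S.roots P₀) :=
    ⟨id, fun v hv ↦ absurd (hall v) hv, fun _ _ ↦ rfl, ⟨fun _ ↦ 0, fun v hv ↦ absurd (hall v) hv⟩⟩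
  rw [Nat.card_eq_one_iff_exists]
  exact ⟨F₀, fun F ↦ Forest.ext (funext fun v ↦ F.root (hall v))⟩

/-! ### The ambient set is stable under peeling -/

/-- `amb` shrinks under the dual step. [folklore] -/
theorem Good.amb_peelE_subset (h : S.Good) (hE : S.CanE) (hb : stepD S.a ≠ S.b) : S.peelE.amb ⊆ S.amb := by
  intro v hv
  rw [mem_amb] at hv ⊢
  rw [h.pts_peelE hE hb] at hv
  have hα' : ∀ x ∈ S.peelE.α, x = farP S.a ∨ x ∈ S.α := by
    intro x hx
    rcases hE.2 with hn | ⟨t, ht⟩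
    · rw [peelE_α_of_notMem hn] at hx
      simpa using hx
    · rw [peelE_α_of_eq ht] at hx
      rw [ht]
      simp only [List.mem_cons] at hx ⊢
      tauto
  rcases hv with hv | ⟨p, hp, rfl⟩ | ⟨p, hp, rfl⟩
  · rcases hα' v hv with rfl | hv
    · exact Or.inr (Or.inr ⟨S.a, S.a_mem_pts, rfl⟩)
    · exact Or.inl hv
  · exact Or.inr (Or.inl ⟨p, Finset.mem_of_mem_erase hp, rfl⟩)
  · exact Or.inr (Or.inr ⟨p, Finset.mem_of_mem_erase hp, rfl⟩)

/-- `amb` shrinks under the primal step. [folklore] -/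
theorem Good.amb_peelP_subset (h : S.Good) (hE : S.swap.CanE) (hb : stepD S.swap.a ≠ S.swap.b) :
    S.peelP.amb ⊆ S.amb := by
  intro v hv
  rw [mem_amb] at hv ⊢
  rw [h.pts_peelP hE hb, peelP_α] at hv
  rcases hv with hv | ⟨p, hp, rfl⟩ | ⟨p, hp, rfl⟩
  · exact Or.inl hv
  · exact Or.inr (Or.inl ⟨p, Finset.mem_of_mem_erase hp, rfl⟩)
  · exact Or.inr (Or.inr ⟨p, Finset.mem_of_mem_erase hp, rfl⟩)

/-! ### The theorem -/

/-- **Spanning trees containing `α` and Peano paths are equinumerous** ([LSW04] §4.1, "`T ↦ γ(T)`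
is a bijection …"): for good peeling data, the rooted spanning forests of the primal graph `H`
rooted at `α` (padded by isolated roots to any ambient `P₀ ⊇ amb S`) are as many as the Peano
paths.  By strong induction on the number of interior Peano vertices, peeling off the first
vertex on both sides. [cite: LawlerSchrammWerner2004, §4.1] -/
theorem Good.card_forest_eq_card_isPath (h : S.Good) (hP : S.amb ⊆ P₀) :
    Nat.card (Forest (S.primalGraph P₀) (S.roots P₀)) = Nat.card {l // S.IsPath l} := by
  classical
  induction hcard : S.V.card using Nat.strong_induction_on generalizing S with
  | _ n IH =>
    by_cases hV : S.V = ∅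
    · rw [card_forest_of_V_eq_empty hV, card_isPath_of_empty h hV]
    -- an interior vertex is present
    have IHE : ∀ (hE : S.CanE),
        Nat.card (Forest (S.peelE.primalGraph P₀) (S.peelE.roots P₀)) =
          Nat.card {l // S.peelE.IsPath l} := fun hE ↦
      IH _ (hcard ▸ h.card_peelE_lt hE (h.stepD_ne_b hV hE)) (h.peelE hE (h.stepD_ne_b hV hE))
        ((h.amb_peelE_subset hE (h.stepD_ne_b hV hE)).trans hP) rfl
    have IHP : ∀ (hE : S.swap.CanE),
        Nat.card (Forest (S.peelP.primalGraph P₀) (S.peelP.roots P₀)) =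
          Nat.card {l // S.swap.peelE.IsPath l} := fun hE ↦ by
      have hb := h.swap.stepD_ne_b (swap_V_ne_empty hV) hE
      rw [← card_isPath_peelP]
      exact IH _ (hcard ▸ h.card_peelP_lt hE hb) (h.peelP_good hE hb) ((h.amb_peelP_subset hE hb).trans hP) rfl
    rw [card_isPath_eq h hV]
    by_cases h2 : s(dualNbr S.a, farD S.a) ∈ edgeSet S.β
    · -- case D: the dual step is blocked; the primal step is available
      have hnE : ¬ S.CanE := fun hE ↦ hE.1 h2
      have hE : S.swap.CanE := h.canE_or.resolve_left hnE
      have hb := h.swap.stepD_ne_b (swap_V_ne_empty hV) hE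
      rw [if_neg hnE, if_pos hE, zero_add, ← IHP hE]
      exact Nat.card_congr (h.forestEquivPeelP hE hb (Or.inr h2))
    by_cases hn : farP S.a ∈ S.α
    · by_cases hB : ∃ t, S.α = primalNbr S.a :: farP S.a :: t
      · -- case B: dual step along the dangling first edge of `α`
        obtain ⟨t, ht⟩ := hB
        have hE : S.CanE := ⟨h2, Or.inr ⟨t, ht⟩⟩
        have hb := h.stepD_ne_b hV hE
        have hnP : ¬ S.swap.CanE := fun hE' ↦ (canE_swap_iff.1 hE').1 (by
          rw [ht, edgeSet_cons_cons]; exact List.mem_cons_self)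
        rw [if_pos hE, if_neg hnP, add_zero, ← IHE hE]
        exact Nat.card_congr (h.forestEquivPeelEOfEq hE hb ht)
      · -- case C: `farP a` deep inside `α`: the dual step is unavailable
        have hnE : ¬ S.CanE := fun hE ↦ hE.2.elim (fun h' ↦ h' hn) hB
        have hE : S.swap.CanE := h.canE_or.resolve_left hnE
        have hb := h.swap.stepD_ne_b (swap_V_ne_empty hV) hE
        rw [if_neg hnE, if_pos hE, zero_add, ← IHP hE]
        exact Nat.card_congr (h.forestEquivPeelP hE hb (Or.inl hn))
    · -- case A: the dual step is available and adds `farP a` to `α`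
      have hE : S.CanE := ⟨h2, Or.inl hn⟩
      have hb := h.stepD_ne_b hV hE
      have h1 : s(primalNbr S.a, farP S.a) ∉ edgeSet S.α := fun hm ↦ hn (mem_of_mem_edgeSet hm).2
      rw [if_pos hE, ← IHE hE, Nat.card_congr (Forest.splitParent (S.W₀ hP) (S.U₀ hP)), Nat.card_sum,
        Nat.card_congr (h.forestUsesEquiv hP hE hb hn)]
      congr 1
      by_cases hfar : farD S.a ∈ S.β
      · -- case C': the primal step is unavailable, and no forest avoids `f₁`
        have hnP : ¬ S.swap.CanE := fun hE' ↦ by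
          rcases (canE_swap_iff.1 hE').2 with hn' | ⟨t, ht⟩
          · exact hn' hfar
          · exact h2 (by rw [ht, edgeSet_cons_cons]; exact List.mem_cons_self)
        rw [if_neg hnP, h.card_forest_avoids_eq_zero hP h2 hn hfar]
      · -- case A': the primal step is available as well
        have hE' : S.swap.CanE := canE_swap_iff.2 ⟨h1, Or.inl hfar⟩
        have hb' := h.swap.stepD_ne_b (swap_V_ne_empty hV) hE'
        rw [if_pos hE', ← IHP hE', Nat.card_congr (h.forestAvoidsEquivDelete hP),
          Nat.card_congr (h.forestDeleteEquivPeelP hP hE' hb')]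

end PeelData


end USTPeano

end Literature.Probability.RandomPlanarGeometry
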